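import Summits.RiemannHypothesis.RiemannHypothesis.Theorems.TiltedLandingLaw421R3ColumnImmunity
import Summits.RiemannHypothesis.RiemannHypothesis.Theorems.TiltedLandingLaw421R3Hurwitz

/-!
# W-08 law421 · C1 (rh-idea-5 g27) — CLUSTER GLUE for STUB 1 (`RestSuccBotQ` ≡ `StepLawQ`)

Director (CA379) residual of record = `AntiEscapeCore` (tree #1053): the lowest band state `v` has an OVERLAPPING non-real
neighbour (a cluster of `c ≥ 2` conjugate pairs).  The cluster mechanism (RESULT-8/RIDER-9 words): if the cluster disc
`D(a, ρ)` is column-deep and DOMINATED on its circle (`‖Q·h′‖ < ‖Q′·h‖`, `F_j = Q·h`, `Q` the cluster polynomial of degree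
`m = 2c + r`), Rouché gives exactly `m − 1` critical points of `F_j` in the disc; at a NON-Ready′ level the real ones number at
most `r + 1` (one simple one per zero-free slot, `μ − 1` at a tooth of multiplicity `μ`), so `≥ 2c − 2 ≥ 2` are non-real and one
of them is an upper zero of `F_{j+1}` in the column: a level-`(j+1)` band state by column immunity.

This file proves the GLUE pieces of that argument against the tree (all sorry-free):
* §1 `exists_upper_zero_of_nonreal` — conjugation symmetry: a non-real zero of `f^{(n)}` yields an UPPER zero with the same abscissa/height.
* §2 ★ `succ_of_nonreal_crit` — a non-real zero of `f^{(j+1)}` within `ρ` (in abscissa) of a centre `a` with `|a − x₀| + ρ ≤ R/2`, at a level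
  carrying a band state ⇒ a level-`(j+1)` band state (no height clause: strip heredity is inside column immunity).
* §3 `re_iteratedDeriv_add_two_ne_zero_of_notReady` — at a non-Ready′ level, an off-tooth real critical point in range is SIMPLE
  (else it is an `NLEventOf` with `F·F″ = 0`).
* §4 `exists_tooth_between_of_notReady` — at a non-Ready′ level, between two real critical points in range lies a zero of `F_j`
  (contrapositive of tree `RhW08.Hurwitz.readyR2_of_two_crit`).
* §5 sockets (statements only, for C3/C4's Rouché desk): `DominatedCluster`, `ClusterCountSig` (exact count `m − 1`),
  `RealCritBoundSig` (real count `≤ r + 1` at non-Ready′ levels), and the door `ClusterLawQ`; ★ `clusterLawQ_of_nonrealWitness`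
  shows the door follows from any mechanism producing ONE non-real critical point in the cluster disc (§2).
Nothing here bears on the truth of RH; `TiltedLandingLaw421` (24774) stays OPEN.
-/

namespace RhW08.ClusterQ

open Complex Set
open scoped ComplexConjugate
open Literature.Analysis.Complex
open RhIdea6.G17.W07C7 RhIdea6.G17.W07C7.Rev6 RhIdea6.G18.W07C8.Law421BirthS RhIdea6.G19.W07C11.Seam
open RhIdea6.G20.W07C12.Frac RhIdea6.G20.W07C12.StColP RhW07.C12.FieldSplit RhIdea6.G21.W07C13.TentMax
open RhW07.C14.TwoSided RhW07.C14.Classes RhW07.C14.Lineage RhW07.C14.Booking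
open RhW07.C13.Heredity RhIdea6.G22.W07C15pre.Injection RhW07.E3.Cell RhW07.E3.Lit
open RhW08.Round1 RhW08.StSwap RhW08.Round2 RhW08.QuadW RhW08.SealSwapQ RhW08.SuccB RhW08.SuccSplit RhW08.SuccTheft
open RhW08.Column RhW08.Hurwitz

/-! ## §1 Conjugation symmetry -/

/-- A non-real zero of `f^{(n)}` (f entire, real on `ℝ`) has an UPPER-half-plane twin with the same abscissa and height. -/
theorem exists_upper_zero_of_nonreal {f : ℂ → ℂ} (hf : Differentiable ℂ f) (hreal : ∀ x : ℝ, (f (x : ℂ)).im = 0) (n : ℕ)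
    {z : ℂ} (hz : iteratedDeriv n f z = 0) (hzim : z.im ≠ 0) :
    ∃ u : ℂ, iteratedDeriv n f u = 0 ∧ 0 < u.im ∧ u.re = z.re ∧ |u.im| = |z.im| := by
  rcases lt_or_gt_of_ne hzim with hneg | hpos
  · refine ⟨conj z, ?_, ?_, ?_, ?_⟩
    · exact conj_zero_of_real_entire (differentiable_iteratedDeriv_of_entire hf n) (im_iteratedDeriv_ofReal hf hreal n) hz
    · rw [Complex.conj_im]; linarith
    · rw [Complex.conj_re]
    · rw [Complex.conj_im, abs_neg]
  · exact ⟨z, hz, hpos, rfl, rfl⟩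

/-! ## §2 Successor from one non-real critical point in a column-deep cluster disc -/

/-- ★ GLUE.  At a level `j` carrying a band state `v`, ONE non-real zero `z` of `f^{(j+1)}` whose abscissa is within `ρ` of a
centre `a` with `|a − x₀| + ρ ≤ R/2` gives a level-`(j+1)` band state (column immunity; no height clause). -/
theorem succ_of_nonreal_crit {η : ℝ} {f : ℂ → ℂ} {x₀ s hmax R Hs : ℝ} {B j : ℕ} {v z : ℂ} {a ρ : ℝ}
    (hE : EngineHyps5 2 η f x₀ s hmax R Hs B) (hv : StTrkDQ η f x₀ s hmax R Hs B j v)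
    (hcol : |a - x₀| + ρ ≤ R / 2) (hz : iteratedDeriv (j + 1) f z = 0) (hzim : z.im ≠ 0) (hza : |z.re - a| ≤ ρ) :
    ∃ u : ℂ, StTrkDQ η f x₀ s hmax R Hs B (j + 1) u := by
  obtain ⟨u, hu0, huim, hure, -⟩ := exists_upper_zero_of_nonreal hE.1 hE.2.1 (j + 1) hz hzim
  have hucol : |u.re - x₀| ≤ R / 2 := by
    have h1 : |u.re - x₀| ≤ |u.re - a| + |a - x₀| := by
      have := abs_add_le (u.re - a) (a - x₀); rwa [show u.re - a + (a - x₀) = u.re - x₀ by ring] at this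
    rw [hure] at h1 ⊢; linarith
  exact ⟨u, stTrkDQ_succ_of_column hE hv hu0 huim hucol⟩

/-- Disc form of §2: `‖z − a‖ ≤ ρ` instead of the abscissa condition. -/
theorem succ_of_nonreal_crit_disc {η : ℝ} {f : ℂ → ℂ} {x₀ s hmax R Hs : ℝ} {B j : ℕ} {v z : ℂ} {a ρ : ℝ}
    (hE : EngineHyps5 2 η f x₀ s hmax R Hs B) (hv : StTrkDQ η f x₀ s hmax R Hs B j v)
    (hcol : |a - x₀| + ρ ≤ R / 2) (hz : iteratedDeriv (j + 1) f z = 0) (hzim : z.im ≠ 0) (hza : ‖z - (a : ℂ)‖ ≤ ρ) :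
    ∃ u : ℂ, StTrkDQ η f x₀ s hmax R Hs B (j + 1) u := by
  refine succ_of_nonreal_crit hE hv hcol hz hzim ?_
  have h1 : |(z - (a : ℂ)).re| ≤ ‖z - (a : ℂ)‖ := Complex.abs_re_le_norm _
  simp only [Complex.sub_re, Complex.ofReal_re] at h1
  exact h1.trans hza

/-! ## §3 Off-tooth real critical points are simple at non-Ready′ levels -/

/-- At a non-Ready′ level `j`, a real zero `x` of `f^{(j+1)}` in range with `f^{(j)}(x) ≠ 0` has `f^{(j+2)}(x) ≠ 0`
(otherwise `x` is an `NLEventOf f j` with `F·F″ = 0 ≥ 0`, making the level Ready′). -/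
theorem re_iteratedDeriv_add_two_ne_zero_of_notReady {η : ℝ} {f : ℂ → ℂ} {x₀ s hmax R Hs : ℝ} {B j : ℕ} {u : ℂ}
    (hnr : ¬ ReadyR2 η f x₀ s hmax R Hs B j u) {x : ℝ} (hx : |x - x₀| < ((j : ℝ) + 3) * R / 2)
    (h1 : (iteratedDeriv (j + 1) f (x : ℂ)).re = 0) (h0 : (iteratedDeriv j f (x : ℂ)).re ≠ 0) :
    (iteratedDeriv (j + 2) f (x : ℂ)).re ≠ 0 := by
  intro h2
  exact hnr ⟨j, le_rfl, Or.inr ⟨x, hx, h1, h0, by rw [h2, mul_zero]⟩⟩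

/-! ## §4 Two real critical points in range enclose a tooth (non-Ready′ levels) -/

/-- At a non-Ready′ level `j`, between two real zeros `c₁ < c₂` of `Re f^{(j+1)}` in range there is a zero of `Re f^{(j)}`
(contrapositive of `RhW08.Hurwitz.readyR2_of_two_crit`): each zero-free slot holds AT MOST ONE real critical point. -/
theorem exists_tooth_between_of_notReady {η : ℝ} {f : ℂ → ℂ} {x₀ s hmax R Hs : ℝ} {B j : ℕ} {u : ℂ}
    (hf : Differentiable ℂ f) (hnr : ¬ ReadyR2 η f x₀ s hmax R Hs B j u) {c₁ c₂ : ℝ} (hlt : c₁ < c₂)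
    (hr₁ : |c₁ - x₀| < ((j : ℝ) + 3) * R / 2) (hr₂ : |c₂ - x₀| < ((j : ℝ) + 3) * R / 2)
    (h1 : (iteratedDeriv (j + 1) f (c₁ : ℂ)).re = 0) (h2 : (iteratedDeriv (j + 1) f (c₂ : ℂ)).re = 0) :
    ∃ x ∈ Icc c₁ c₂, (iteratedDeriv j f (x : ℂ)).re = 0 := by
  by_contra h
  push Not at h
  exact hnr (readyR2_of_two_crit hf η x₀ s hmax R Hs B j u hlt hr₁ hr₂ h1 h2 h)

/-! ## §5 Sockets for the Rouché desk and the door -/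

/-- Zero count (with multiplicity) of `g` in the open disc `‖u − a‖ < ρ`. -/
noncomputable def zcount (g : ℂ → ℂ) (a ρ : ℝ) : ℝ :=
  ∑ᶠ u ∈ {u : ℂ | g u = 0 ∧ ‖u - (a : ℂ)‖ < ρ}, ((analyticOrderAt g u).toNat : ℝ)

/-- Real-zero count (with multiplicity) of `g` in the open disc. -/
noncomputable def zcountReal (g : ℂ → ℂ) (a ρ : ℝ) : ℝ :=
  ∑ᶠ u ∈ {u : ℂ | g u = 0 ∧ ‖u - (a : ℂ)‖ < ρ ∧ u.im = 0}, ((analyticOrderAt g u).toNat : ℝ)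

/-- Non-real-zero count (with multiplicity) of `g` in the open disc. -/
noncomputable def zcountNonreal (g : ℂ → ℂ) (a ρ : ℝ) : ℝ :=
  ∑ᶠ u ∈ {u : ℂ | g u = 0 ∧ ‖u - (a : ℂ)‖ < ρ ∧ u.im ≠ 0}, ((analyticOrderAt g u).toNat : ℝ)

/-- DOMINATED CLUSTER of `G` in `D(a, ρ)`: `G = Q·h` with `Q` a polynomial map of degree `m` having all its roots in the open
disc, `h` entire and zero-free on the closed disc, and Rouché domination `‖Q·h′‖ < ‖Q′·h‖` on the circle. -/
def DominatedCluster (G : ℂ → ℂ) (a ρ : ℝ) (m : ℕ) : Prop :=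
  ∃ (Q : Polynomial ℂ) (h : ℂ → ℂ), Q.natDegree = m ∧ (∀ z : ℂ, G z = Q.eval z * h z) ∧ Differentiable ℂ h ∧
    (∀ z : ℂ, ‖z - (a : ℂ)‖ ≤ ρ → h z ≠ 0) ∧ (∀ z : ℂ, Q.eval z = 0 → ‖z - (a : ℂ)‖ < ρ) ∧
    (∀ z : ℂ, ‖z - (a : ℂ)‖ = ρ → ‖Q.eval z * deriv h z‖ < ‖(Polynomial.derivative Q).eval z * h z‖)

/-- SOCKET (Rouché desk, C3/C4): a dominated cluster of degree `m ≥ 1` has exactly `m − 1` critical points in the disc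
(Rouché `G′` vs `Q′·h` on the circle + Gauss–Lucas for `Q′`). -/
def ClusterCountSig : Prop :=
  ∀ (G : ℂ → ℂ) (a ρ : ℝ) (m : ℕ), 0 < ρ → 1 ≤ m → Differentiable ℂ G → DominatedCluster G a ρ m →
    zcount (deriv G) a ρ = (m : ℝ) - 1

/-- SOCKET (real pigeonhole, C1/C2): at a NON-Ready′ level `j` whose disc slice lies in range, the real critical points of
`f^{(j)}` in the disc number at most (real zeros of `f^{(j)}` in the disc, with multiplicity) `+ 1` — one simple critical point per
zero-free slot (§3, §4) and `μ − 1` at a tooth of multiplicity `μ`. -/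
def RealCritBoundSig : Prop :=
  ∀ (η : ℝ) (f : ℂ → ℂ) (x₀ s hmax R Hs : ℝ) (B : ℕ), EngineHyps5 2 η f x₀ s hmax R Hs B →
    ∀ (j : ℕ) (v : ℂ) (a ρ : ℝ), iteratedDeriv j f ≠ 0 → ¬ ReadyR2 η f x₀ s hmax R Hs B j v →
      |a - x₀| + ρ < ((j : ℝ) + 3) * R / 2 →
      zcountReal (iteratedDeriv (j + 1) f) a ρ ≤ zcountReal (iteratedDeriv j f) a ρ + 1

/-- ★ THE CLUSTER DOOR (sufficient for the `AntiEscapeCore`-type residual when the overlapping neighbours form a dominated,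
column-deep cluster): legal frame, band state at level `j`, level not Ready′, a dominated cluster disc `D(a, ρ)` of `f^{(j)}` with
`|a − x₀| + ρ ≤ R/2` holding at least FOUR MORE zeros than real zeros (two conjugate pairs) ⇒ a level-`(j+1)` band state. -/
def ClusterLawQ : Prop :=
  ∀ (η : ℝ) (f : ℂ → ℂ) (x₀ s hmax R Hs : ℝ) (B : ℕ), EngineHyps5 2 η f x₀ s hmax R Hs B →
    ∀ (j : ℕ) (v : ℂ) (a ρ : ℝ) (m : ℕ), StTrkDQ η f x₀ s hmax R Hs B j v → ¬ ReadyR2 η f x₀ s hmax R Hs B j v →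
      0 < ρ → |a - x₀| + ρ ≤ R / 2 → DominatedCluster (iteratedDeriv j f) a ρ m →
      zcountReal (iteratedDeriv j f) a ρ + 4 ≤ (m : ℝ) →
      ∃ u : ℂ, StTrkDQ η f x₀ s hmax R Hs B (j + 1) u

/-- SOCKET (bookkeeping): in the situation of `ClusterLawQ`, the two counts force a NON-REAL critical point in the disc
(`zcount = zcountReal + zcountNonreal` over a finite zero set, `m − 1 − (r + 1) ≥ 2 > 0`). -/
def NonrealWitnessSig : Prop :=
  ∀ (η : ℝ) (f : ℂ → ℂ) (x₀ s hmax R Hs : ℝ) (B : ℕ), EngineHyps5 2 η f x₀ s hmax R Hs B →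
    ∀ (j : ℕ) (v : ℂ) (a ρ : ℝ) (m : ℕ), StTrkDQ η f x₀ s hmax R Hs B j v → ¬ ReadyR2 η f x₀ s hmax R Hs B j v →
      0 < ρ → |a - x₀| + ρ ≤ R / 2 → DominatedCluster (iteratedDeriv j f) a ρ m →
      zcountReal (iteratedDeriv j f) a ρ + 4 ≤ (m : ℝ) →
      ∃ z : ℂ, iteratedDeriv (j + 1) f z = 0 ∧ z.im ≠ 0 ∧ ‖z - (a : ℂ)‖ < ρ

/-- ★ K: the door follows from the non-real witness (which the Rouché count + real pigeonhole + bookkeeping produce). -/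
theorem clusterLawQ_of_nonrealWitness (hW : NonrealWitnessSig) : ClusterLawQ := by
  intro η f x₀ s hmax R Hs B hE j v a ρ m hv hnr hρ hcol hD hm
  obtain ⟨z, hz, hzim, hza⟩ := hW η f x₀ s hmax R Hs B hE j v a ρ m hv hnr hρ hcol hD hm
  exact succ_of_nonreal_crit_disc hE hv hcol hz hzim hza.le

/-- `R > 0` on a legal frame. -/
theorem R_pos_of_engine {η : ℝ} {f : ℂ → ℂ} {x₀ s hmax R Hs : ℝ} {B : ℕ} (hE : EngineHyps5 2 η f x₀ s hmax R Hs B) : 0 < R := by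
  have h1 := hE.2.2.2.1; have h2 := hE.2.2.2.2.1; have h3 := hE.2.2.2.2.2.1; linarith

/-- Counts are nonnegative. -/
theorem zcountReal_nonneg (g : ℂ → ℂ) (a ρ : ℝ) : 0 ≤ zcountReal g a ρ :=
  finsum_nonneg fun _ => finsum_nonneg fun _ => Nat.cast_nonneg _

/-- ★★ K (bookkeeping, PROVED): the Rouché count socket and the real-pigeonhole socket together produce the non-real witness —
`zcount = zcountReal + zcountNonreal` over the finite zero set of `f^{(j+1)}` in the disc, and `(m − 1) − (r + 1) ≥ 2 > 0`. -/
theorem nonrealWitness_of_count_realBound (hC : ClusterCountSig) (hRB : RealCritBoundSig) : NonrealWitnessSig := by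
  intro η f x₀ s hmax R Hs B hE j v a ρ m hv hnr hρ hcol hD hm
  have hRpos : 0 < R := R_pos_of_engine hE
  have hm1 : 1 ≤ m := by
    have h0 := zcountReal_nonneg (iteratedDeriv j f) a ρ
    have h4 : (1 : ℝ) ≤ (m : ℝ) := by linarith
    exact_mod_cast h4
  have hcount := hC (iteratedDeriv j f) a ρ m hρ hm1 (differentiable_iteratedDeriv_of_entire hE.1 j) hD
  rw [← iteratedDeriv_succ] at hcount
  have hrange : |a - x₀| + ρ < ((j : ℝ) + 3) * R / 2 := by
    have hj : (0 : ℝ) ≤ (j : ℝ) := Nat.cast_nonneg j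
    nlinarith
  have hreal := hRB η f x₀ s hmax R Hs B hE j v a ρ hv.1 hnr hrange
  set g := iteratedDeriv (j + 1) f with hg
  have hgne : g ≠ 0 := iteratedDeriv_succ_ne_zero_of_zero hE.1 j hv.1 hv.2.1
  have hfin : {u : ℂ | g u = 0 ∧ ‖u - (a : ℂ)‖ < ρ}.Finite := by
    refine (finite_zeros_closedBall_of_entire (differentiable_iteratedDeriv_of_entire hE.1 (j + 1)) hgne (a : ℂ) ρ).subset ?_
    intro u hu
    exact ⟨Metric.mem_closedBall.mpr (by rw [dist_eq_norm]; exact hu.2.le), hu.1⟩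
  have hset : {u : ℂ | g u = 0 ∧ ‖u - (a : ℂ)‖ < ρ} =
      {u : ℂ | g u = 0 ∧ ‖u - (a : ℂ)‖ < ρ ∧ u.im = 0} ∪ {u : ℂ | g u = 0 ∧ ‖u - (a : ℂ)‖ < ρ ∧ u.im ≠ 0} := by
    ext u; simp only [mem_setOf_eq, mem_union]; tauto
  have hdisj : Disjoint {u : ℂ | g u = 0 ∧ ‖u - (a : ℂ)‖ < ρ ∧ u.im = 0} {u : ℂ | g u = 0 ∧ ‖u - (a : ℂ)‖ < ρ ∧ u.im ≠ 0} :=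
    Set.disjoint_left.mpr fun u hu hu' => hu'.2.2 hu.2.2
  have hsplit : zcount g a ρ = zcountReal g a ρ + zcountNonreal g a ρ := by
    unfold zcount zcountReal zcountNonreal
    rw [hset, finsum_mem_union hdisj (hfin.subset fun u hu => ⟨hu.1, hu.2.1⟩) (hfin.subset fun u hu => ⟨hu.1, hu.2.1⟩)]
  have hpos : 0 < zcountNonreal g a ρ := by linarith
  by_contra hno
  push Not at hno
  have hempty : {u : ℂ | g u = 0 ∧ ‖u - (a : ℂ)‖ < ρ ∧ u.im ≠ 0} = ∅ := by
    ext u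
    simp only [mem_setOf_eq, mem_empty_iff_false, iff_false, not_and]
    intro hu hua him
    exact absurd hua (not_lt.mpr (hno u hu him))
  have h0 : zcountNonreal g a ρ = 0 := by unfold zcountNonreal; rw [hempty, finsum_mem_empty]
  linarith

/-- ★★ Hence the cluster door is reduced to the two analytic sockets. -/
theorem clusterLawQ_of_count_realBound (hC : ClusterCountSig) (hRB : RealCritBoundSig) : ClusterLawQ :=
  clusterLawQ_of_nonrealWitness (nonrealWitness_of_count_realBound hC hRB)

end RhW08.ClusterQ
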